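import Literature.AlgebraicGeometry.AbelianSchemes.RingActionLieSignatureSpecialPoint     -- ★ (S-T) FILE 1 (A-p17 g26): `hsig_baseChange_of_lieCharpoly_eq_prod`, `charpoly_cotangentMap_baseChange_i`, …
import Literature.AlgebraicGeometry.AbelianSchemes.AbelianSchemeFibreAlongIntegralPoint        -- ★ (d5): `exists_iso_fibre_generic∕special_along_extendPoint`, point equalities
import Literature.AlgebraicGeometry.Motives.IntegralModelReductionMapSurjective              -- ★ `IntegralModel.geomReductionMap_surjective_of_isSmoothProper`
import Literature.AlgebraicGeometry.Motives.AbelianVarietyAnalyticCharacterInvariance        -- ★ `charpoly_cotangentMap_eq_of_comp_eq_nsmul`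
import HarnessLib

/-!
# Socket (S-T) in the datum's frame: the Lie signature of the `w′`-block is `1` on the special fibre of the tuple lifted over the
# valuation ring `R ⊆ F̄_w` of a point of the model, and on the datum's own special fibre (frame (R-β) of LEAD M-17w)

Topic `Literature/AlgebraicGeometry/HodgeTheory`; namespace `Literature.AlgebraicGeometry.HodgeTheory.RingAction`.  THEOREMS ONLY (no
definition, no named fact, no instance, no notation, no `sorry`).  Cell `hodgecm-mathlib` (D-0151), FLOOR 0, P6 «MOD programme» (crux
hLiu418 = stmt-HodgeConjecture-24832, `--supports`): FILE 2 (THE RECORD INSTANCE) of the junction **(S-T) «KOTTWITZ ⇒ LIE SIGNATURE AT x̄»**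
(A-p17 (g26), 2026-09-01; LEAD F0P6-plan (g2) 20:46:50Z (1), K∕BT desk F0P6d-plan (g2) SOCKET NOTE 20:47:10Z) = the supplier of the `hsig`
binder of ED. 7 `Cruxes/HLiu418/Lines/F0_P6d_BlockDocking.lean` (`blockDocking_of_line` :80) at `A := sch₀Of 𝓜 w 𝒜 x̄ = (𝒜 ×_𝓨 𝓨_s) ×_{𝓨_s} x̄`
(seam (i) `rfl`), mirror of ★ A-p18 (S-H) `IntegralModelSpecialPointBlockHeight`.

THE MATHEMATICS.  `𝓨` a proper model over `𝒪_{F,(w)}` of `Y`, `𝒜 → 𝓨` an abelian scheme of relative dimension `g` with a ring action `act` of `O`,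
`w′` a maximal ideal of `O` with block data `(p) = w′^e 𝔟`, `w′ + 𝔟 = O`, `(a_n)` (★ `BlockIdempotentFamily`); `y ∈ Y(Ω)`, `Ω = F̄_w`, `R ⊆ Ω` the
valuation ring (LOCAL, residue field `≅ κ̄(w)`), `x̃ : Spec R → 𝓨` the lift of `y` (★ `extendPoint`).  INPUT (K-Ω), in the desk's `cotangentMap` currency:
on the Ω-fibre tuple `(𝒜|_Y)_y` the cotangent map of `ι_y(a₁)` has characteristic polynomial `∏_{i∈s} (T − c_i)^{m_i}` with roots `c_i ∈ R` (in print
`i = τ : F ↪ Ω`, `c_τ = τ(a₁)`, `m_τ = r_τ` the signature; [Kottwitz1992] §5, [RapoportSmithlingZhang2020Diagonal] §4.1 (4.6)), and the COUNT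
`Σ_{i : c_i ≡ 1 mod 𝔪_R} m_i = 1` (exactly one embedding inducing `w′` has `r = 1`, [RapoportSmithlingZhang2020Diagonal] (4.19), [Liu2021] Remark C.2
p. 108, p. 137; §1 turns `c_τ ≡ 1` into «`τ` induces `w′`»).  CHAIN: `(𝒜|_Y)_y ≅ (𝒜_x̃)_Ω` equivariantly (★ `exists_iso_fibre_generic_along_extendPoint`)
and cotangent characteristic polynomials are invariants of equivariant isomorphisms (★ `charpoly_cotangentMap_eq_of_comp_eq_nsmul`, `n = 1`), so
★ FILE 1 §2 (`R ↪ Ω` injective) PINS `char(T, ι(a₁) | Lie(𝒜_x̃∕R)) = ∏ (T − c_i)^{m_i}` in `R[T]` (§2); ★ FILE 1 HEAD at the closed point `gκ` gives `hsig`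
on `(𝒜_x̃)_{κ̄}` (§2); ★ FILE 1 §1 + the `n = 1` invariance along ★ `exists_iso_fibre_special_along_extendPoint` + ★ FILE 1 §4 give `hsig` on the datum's
own special fibre at `red y` (§3); every special point of a SMOOTH proper model is a reduction (★ `geomReductionMap_surjective_of_isSmoothProper`) (§4).

* §1 `map_blockIdempotent_one_eq_zero_or_ker_eq`, **`map_blockIdempotent_one_eq_one_iff`** — for `ψ : O → κ` into a field of characteristic `p`:
  `ψ(a₁) = 1 ↔ ker ψ = w′` (else `ψ(a₁) = 0`): the count `Σ_{ψ_i(a₁) = 1} m_i` IS the sum over the embeddings inducing `w′`.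
* §2 `specialPoint_eq_specMap` (the closed point of record is `Spec` of `R → κ(R) ≅ κ̄(w)`), **`lieCharpoly_extendPoint_eq_prod`** (Kottwitz descends to `R`),
  **`hsig_specialFibre_extendPoint`** (`hsig` on `((𝒜.baseChange x̃).baseChange gκ, …)`).
* §3 **`hsig_specialFibre_geomReductionMap`** (`hsig` on `((𝒜.baseChange ι_s).baseChange (red y).left, …)` = the datum's `sch₀Of ∕ act₀Of` shape).
* §4 **`hsig_specialFibre_of_isSmoothProper`** — THE ED. 7 `hsig` BINDER at every `x̄ ∈ 𝓨_s(κ̄(w))` of a smooth proper model.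

HC_CM is proved only modulo the printed citations (2 remaining named inputs hLiu418 24832, h413 24833) until rung 0 closes; this file is
generic and changes no count.

## References
* [Kottwitz1992] R. E. Kottwitz, *Points on some Shimura varieties over finite fields*, JAMS 5 (1992), §5 (p. 390).
* [RapoportSmithlingZhang2020Diagonal] M. Rapoport, B. Smithling, W. Zhang, Compos. Math. 156 (2020), §4.1 (4.5)–(4.6) p. 16, (4.19) p. 19.
* [Liu2021] Y. Liu, *Fourier–Jacobi cycles and arithmetic relative trace formula*, Camb. J. Math. 9 (2021), Remark C.2 p. 108, §D.4 p. 134, p. 137.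
* [SerreTate1968] J.-P. Serre, J. Tate, *Good reduction of abelian varieties*, Ann. of Math. 88 (1968), §1 (the reduction map).
* [Neukirch1999] J. Neukirch, *Algebraic Number Theory* (1999), Ch. I §3 (3.6), Ch. I §8.
* [GortzWedhorn2020] U. Görtz, T. Wedhorn, *Algebraic Geometry I* (2nd ed., 2020), Section (4.7).
-/

set_option autoImplicit false

noncomputable section

-- `X.toAffine.toAbelianVariety.X = X.X`, `(A.fibre s) = (A.baseChange s).toAffine`, `(Over.mk f).left` etc. are definitional only above
-- `instances` transparency (as in ★ `IntegralModelSpecialPointBlockHeight`, ★ `AbelianSchemeFibreAlongIntegralPoint`).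
set_option backward.isDefEq.respectTransparency false

open CategoryTheory CategoryTheory.Limits AlgebraicGeometry MonoidalCategory CartesianMonoidalCategory Polynomial
open scoped MonObj NumberField CategoryTheory.Obj


universe u v

namespace Literature.AlgebraicGeometry.HodgeTheory

namespace RingAction

open Literature.AlgebraicGeometry.AbelianSchemes Literature.AlgebraicGeometry.AbelianSchemes.AbelianSchemeOver
open Literature.AlgebraicGeometry.AbelianSchemes.AbelianSchemeOver.RingAction
open Literature.AlgebraicGeometry.Motives Literature.AlgebraicGeometry.Motives.AbelianVariety
open Literature.RingTheory.DedekindDomain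
open IsDedekindDomain IsDedekindDomain.HeightOneSpectrum
open Literature.NumberTheory.EllipticCurves (genericFibre specGenericPoint)
open Literature.NumberTheory.GaloisRepresentations (closureValuationSubring)
open Literature.NumberTheory.DiophantineGeometry

/-! ## §1 Root count of a block family at a field-valued point: `ψ(a₁) = 1 ↔ ker ψ = w′` -/

section RootCount

variable {O : Type*} [CommRing O] {κ : Type*} [Field κ] {p : ℕ} [CharP κ p] (ψ : O →+* κ)
  {w' 𝔟 : Ideal O} [w'.IsMaximal] {e : ℕ} (he : 0 < e) (hx : Ideal.span {(p : O)} = w' ^ e * 𝔟)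
  (a : ℕ → O) (ha1 : ∀ n, a n - 1 ∈ w' ^ (e * n)) (ha2 : ∀ n, a n ∈ 𝔟 ^ n)

include he hx ha2 in
/-- **At a field-valued point `ψ : O → κ` of characteristic `p`, EITHER `ker ψ = w′` OR `ψ(a₁) = 0`.**  `ker ψ` is a prime ideal containing
`p`, and `(p) = w′^e 𝔟`; so `w′ ⊆ ker ψ` (then `=`, `w′` maximal) or `𝔟 ⊆ ker ψ` (then `ψ(a₁) = 0` as `a₁ ∈ 𝔟`).  In print: an embedding
`τ : F ↪ Ω̄_p` induces a place `w_τ ∣ p` of `F`, and `τ(a₁) ≡ 0 mod 𝔪` unless `w_τ = w′`. [cite: Neukirch1999, Ch. I §8 (8.1)–(8.3)] [cite: Kottwitz1992, §5 (p. 390)] -/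
theorem map_blockIdempotent_one_eq_zero_or_ker_eq : RingHom.ker ψ = w' ∨ ψ (a 1) = 0 := by
  have hp : (p : O) ∈ RingHom.ker ψ := by
    rw [RingHom.mem_ker, map_natCast, CharP.cast_eq_zero]
  have hle : w' ^ e * 𝔟 ≤ RingHom.ker ψ := by
    rw [← hx, Ideal.span_singleton_le_iff_mem]
    exact hp
  haveI : (RingHom.ker ψ).IsPrime := RingHom.ker_isPrime ψ
  rcases (Ideal.IsPrime.mul_le (RingHom.ker_isPrime ψ)).mp hle with hw | hb
  · left
    have hw1 : w' ≤ RingHom.ker ψ := (Ideal.IsPrime.pow_le_iff (Nat.pos_iff_ne_zero.mp he)).mp hw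
    exact (Ideal.IsMaximal.eq_of_le inferInstance (RingHom.ker_ne_top ψ) hw1).symm
  · exact Or.inr (hb (by simpa only [pow_one] using ha2 1))

include he hx ha1 ha2 in
/-- **`ψ(a₁) = 1 ↔ ker ψ = w′`** for a block family `(a_n)` of `w′` (`a₁ ≡ 1 mod w′^e`, `a₁ ∈ 𝔟`, `e ≥ 1`) and a field-valued point `ψ : O → κ` of
characteristic `p`.  Hence, for the roots `c_τ = τ(a₁)` of the Kottwitz polynomial read at a special point, `Σ_{τ : c̄_τ = 1} r_τ = Σ_{τ inducing w′} r_τ`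
— the (S-T) count is the number (with signature multiplicity) of embeddings inducing the place of the block. [cite: Liu2021, Remark C.2 p. 108; p. 137]
[cite: RapoportSmithlingZhang2020Diagonal, §4.1 (4.6) p. 16 and (4.19) p. 19] [cite: Neukirch1999, Ch. I §8 (8.1)–(8.3)] -/
theorem map_blockIdempotent_one_eq_one_iff : ψ (a 1) = 1 ↔ RingHom.ker ψ = w' := by
  constructor
  · intro h1
    rcases map_blockIdempotent_one_eq_zero_or_ker_eq ψ he hx a ha2 with h | h
    · exact h
    · rw [h] at h1
      exact absurd h1 zero_ne_one
  · intro hker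
    have hmem : a 1 - 1 ∈ RingHom.ker ψ := by
      rw [hker]
      exact Ideal.pow_le_self (Nat.pos_iff_ne_zero.mp (by simpa only [mul_one] using he)) (by simpa only [mul_one] using ha1 1)
    rwa [RingHom.mem_ker, map_sub, map_one, sub_eq_zero] at hmem

end RootCount

/-- Plumbing: the ED. 7 endomorphism `homMk (Grp.ofHom (ι(r)))` of a doubly base-changed fibre IS ★ `fibreHom (baseChangeHom (ι r) j) y` (same
underlying `Over`-morphism). [cite: GortzWedhorn2020, Section (4.7)] -/
theorem homMk_baseChange_i_eq_fibreHom {S T : Scheme.{u}} {𝒜 : AbelianSchemeOver S} {O : Type v} [CommRing O] (act : RingAction O 𝒜)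
    (j : T ⟶ S) {Ω : Type u} [Field Ω] (y : Spec (.of Ω) ⟶ T) (r : O) :
    haveI := ((act.baseChange j).baseChange y).isMonHom_i r
    haveI := act.isMonHom_i r
    (InducedCategory.homMk (Grp.ofHom (A := ((𝒜.baseChange j).baseChange y).X) (B := ((𝒜.baseChange j).baseChange y).X)
        (((act.baseChange j).baseChange y).i r)) :
          ((𝒜.baseChange j).baseChange y).toAffine.toAbelianVariety ⟶ ((𝒜.baseChange j).baseChange y).toAffine.toAbelianVariety) =
      fibreHom (baseChangeHom (act.i r) j) y := by
  apply AbelianVariety.hom_ext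
  rfl

/-! ## §2 The lifted frame: Kottwitz descends to the valuation ring `R`; `hsig` on the special fibre of `𝒜_x̃` -/

section Lifted

variable {F : Type} [Field F] [NumberField F] {w : HeightOneSpectrum (𝓞 F)} {Y : SchemeOver F}
  (𝓨 : IntegralModel (valuationSubringAtPrime F w) F Y) [IsProper 𝓨.total.hom]
  {𝒜 : AbelianSchemeOver 𝓨.total.left} {g : ℕ} (hg : 𝒜.IsOfRelDim g)
  {O : Type v} [CommRing O] (act : RingAction O 𝒜)

/-- **The geometric closed point of `Spec R` used by ★ `exists_iso_fibre_special_along_extendPoint` is `Spec` of the ring map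
`R → κ(R) ≅ κ̄(w)`** (`residue` followed by the inverse of ★ `geomResidueFieldEquiv`). [cite: SerreTate1968, §1] -/
theorem specialPoint_eq_specMap :
    (geomClosedPointIsoSpecResidueField w).inv.left ≫
        (specRingHomι (closureValuationSubring (w.adicCompletion F)) (toClosureValuationSubring w)
          (IsLocalRing.residue ↥(closureValuationSubring (w.adicCompletion F)))).left =
      Spec.map (CommRingCat.ofHom (((geomResidueFieldEquiv w).symm.toRingEquiv.toRingHom).comp
        (IsLocalRing.residue ↥(closureValuationSubring (w.adicCompletion F))))) := by
  rw [CommRingCat.ofHom_comp, Spec.map_comp]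
  rfl

variable (y : AlgPoints Y (AlgebraicClosure (w.adicCompletion F))) (r : O) {σ : Type*} (s : Finset σ)
  (c : σ → ↥(closureValuationSubring (w.adicCompletion F))) (m : σ → ℕ)
  (hK : letI ιη := 𝓨.genericIso'.inv.left ≫ pullback.fst 𝓨.total.hom (specGenericPoint (valuationSubringAtPrime F w) F)
    haveI := ((act.baseChange ιη).baseChange y.left).isMonHom_i r
    (cotangentMap ((𝒜.baseChange ιη).baseChange y.left).toAffine.toAbelianVariety
        (InducedCategory.homMk (Grp.ofHom (A := ((𝒜.baseChange ιη).baseChange y.left).X) (B := ((𝒜.baseChange ιη).baseChange y.left).X)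
          (((act.baseChange ιη).baseChange y.left).i r)))).charpoly =
      ∏ i ∈ s, (Polynomial.X - Polynomial.C (algebraMap ↥(closureValuationSubring (w.adicCompletion F))
        (AlgebraicClosure (w.adicCompletion F)) (c i))) ^ m i)

include hK in
/-- **KOTTWITZ DESCENDS TO THE VALUATION RING.**  If the cotangent map of `ι_y(r)` on the Ω-fibre tuple `(𝒜|_Y)_y` at `y ∈ Y(Ω)` has characteristic
polynomial `∏_{i∈s} (T − c_i)^{m_i}` with `c_i ∈ R ⊆ Ω` the valuation ring, then the chart-free Lie characteristic polynomial of `ι(r)` on the LIFTED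
family `𝒜_x̃ → Spec R` (`x̃ = extendPoint (modelPointsEquiv⁻¹ y)`) is `∏ (T − c_i)^{m_i}` in `R[T]`: `(𝒜|_Y)_y ≅ (𝒜_x̃)_Ω` compatibly with `ι(r)`
(★ `exists_iso_fibre_generic_along_extendPoint`), the cotangent characteristic polynomial is invariant under equivariant isomorphisms
(★ `charpoly_cotangentMap_eq_of_comp_eq_nsmul`, `n = 1`), and `R ↪ Ω` is injective (★ FILE 1 `lieCharpoly_i_eq_of_charpoly_cotangentMap_eq_map`).
[cite: Kottwitz1992, §5 (p. 390)] [cite: SerreTate1968, §1] -/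
theorem lieCharpoly_extendPoint_eq_prod :
    letI xt : Spec (.of ↥(closureValuationSubring (w.adicCompletion F))) ⟶ 𝓨.total.left :=
      (extendPoint (closureValuationSubring (w.adicCompletion F)) (toClosureValuationSubring w) 𝓨.total (𝓨.modelPointsEquiv.symm y)).left
    haveI := (act.baseChange xt).isMonHom_i r
    AbelianScheme.lieCharpoly (𝒜.baseChange xt).toAffine (hg.baseChange xt) ((act.baseChange xt).i r)
        ((𝒜.baseChange xt).toAffine.unit_left_comp_left ((act.baseChange xt).i r)) =
      ∏ i ∈ s, (Polynomial.X - Polynomial.C (c i)) ^ m i := by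
  obtain ⟨eG, -, hnat⟩ := exists_iso_fibre_generic_along_extendPoint 𝓨 y
  let ιη := 𝓨.genericIso'.inv.left ≫ pullback.fst 𝓨.total.hom (specGenericPoint (valuationSubringAtPrime F w) F)
  let xt : Spec (.of ↥(closureValuationSubring (w.adicCompletion F))) ⟶ 𝓨.total.left :=
    (extendPoint (closureValuationSubring (w.adicCompletion F)) (toClosureValuationSubring w) 𝓨.total (𝓨.modelPointsEquiv.symm y)).left
  let ηR : Spec (.of (AlgebraicClosure (w.adicCompletion F))) ⟶ Spec (.of ↥(closureValuationSubring (w.adicCompletion F))) :=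
    (specFractionFieldι (closureValuationSubring (w.adicCompletion F)) (toClosureValuationSubring w)).left
  haveI := act.isMonHom_i r
  haveI := ((act.baseChange ιη).baseChange y.left).isMonHom_i r
  haveI := ((act.baseChange xt).baseChange ηR).isMonHom_i r
  -- the equivariance of the along-`x̃` isomorphism for `ι(r)`, as abelian-variety homomorphisms
  have hu : (InducedCategory.homMk (Grp.ofHom (A := ((𝒜.baseChange ιη).baseChange y.left).X) (B := ((𝒜.baseChange ιη).baseChange y.left).X)
        (((act.baseChange ιη).baseChange y.left).i r)) :
          ((𝒜.baseChange ιη).baseChange y.left).toAffine.toAbelianVariety ⟶ ((𝒜.baseChange ιη).baseChange y.left).toAffine.toAbelianVariety) ≫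
        (eG 𝒜).hom =
      (eG 𝒜).hom ≫ (InducedCategory.homMk (Grp.ofHom (A := ((𝒜.baseChange xt).baseChange ηR).X) (B := ((𝒜.baseChange xt).baseChange ηR).X)
        (((act.baseChange xt).baseChange ηR).i r)) :
          ((𝒜.baseChange xt).baseChange ηR).toAffine.toAbelianVariety ⟶ ((𝒜.baseChange xt).baseChange ηR).toAffine.toAbelianVariety) := by
    rw [homMk_baseChange_i_eq_fibreHom act ιη y.left r, homMk_baseChange_i_eq_fibreHom act xt ηR r]
    exact hnat 𝒜 𝒜 (act.i r)
  have h1 : (eG 𝒜).hom ≫ (eG 𝒜).inv = (1 : ℕ) • 𝟙 _ := by rw [one_smul]; exact (eG 𝒜).hom_inv_id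
  have h2 : (eG 𝒜).inv ≫ (eG 𝒜).hom = (1 : ℕ) • 𝟙 _ := by rw [one_smul]; exact (eG 𝒜).inv_hom_id
  have hχ := charpoly_cotangentMap_eq_of_comp_eq_nsmul h1 h2 (by rw [Nat.cast_one]; exact one_ne_zero) hu
  -- `R ↪ Ω` pins the polynomial over `R`
  refine (act.baseChange xt).lieCharpoly_i_eq_of_charpoly_cotangentMap_eq_map (hg.baseChange xt) r ηR
    (algebraMap ↥(closureValuationSubring (w.adicCompletion F)) (AlgebraicClosure (w.adicCompletion F))) rfl
    (IsFractionRing.injective ↥(closureValuationSubring (w.adicCompletion F)) (AlgebraicClosure (w.adicCompletion F))) _ ?_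
  have hχ' : (cotangentMap ((𝒜.baseChange xt).baseChange ηR).toAffine.toAbelianVariety
      (InducedCategory.homMk (Grp.ofHom (A := ((𝒜.baseChange xt).baseChange ηR).X) (B := ((𝒜.baseChange xt).baseChange ηR).X)
        (((act.baseChange xt).baseChange ηR).i r)))).charpoly =
      (cotangentMap ((𝒜.baseChange ιη).baseChange y.left).toAffine.toAbelianVariety
        (InducedCategory.homMk (Grp.ofHom (A := ((𝒜.baseChange ιη).baseChange y.left).X) (B := ((𝒜.baseChange ιη).baseChange y.left).X)
          (((act.baseChange ιη).baseChange y.left).i r)))).charpoly :=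
    hχ.symm
  rw [hχ', hK, Polynomial.map_prod]
  simp only [Polynomial.map_pow, Polynomial.map_sub, Polynomial.map_X, Polynomial.map_C]

variable [IsCommMonObj 𝒜.X] {p : ℕ} {w' 𝔟 : Ideal O} {e : ℕ} (hx : Ideal.span {(p : O)} = w' ^ e * 𝔟) (hcop : w' ⊔ 𝔟 = ⊤)
  (a : ℕ → O) (ha1 : ∀ n, a n - 1 ∈ w' ^ (e * n)) (ha2 : ∀ n, a n ∈ 𝔟 ^ n)
  (hK₁ : letI ιη := 𝓨.genericIso'.inv.left ≫ pullback.fst 𝓨.total.hom (specGenericPoint (valuationSubringAtPrime F w) F)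
    haveI := ((act.baseChange ιη).baseChange y.left).isMonHom_i (a 1)
    (cotangentMap ((𝒜.baseChange ιη).baseChange y.left).toAffine.toAbelianVariety
        (InducedCategory.homMk (Grp.ofHom (A := ((𝒜.baseChange ιη).baseChange y.left).X) (B := ((𝒜.baseChange ιη).baseChange y.left).X)
          (((act.baseChange ιη).baseChange y.left).i (a 1))))).charpoly =
      ∏ i ∈ s, (Polynomial.X - Polynomial.C (algebraMap ↥(closureValuationSubring (w.adicCompletion F))
        (AlgebraicClosure (w.adicCompletion F)) (c i))) ^ m i)
  [CharP (geomResidueField w) p] [DecidableEq (IsLocalRing.ResidueField ↥(closureValuationSubring (w.adicCompletion F)))]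
  (h1 : ∑ i ∈ s with IsLocalRing.residue ↥(closureValuationSubring (w.adicCompletion F)) (c i) = 1, m i = 1)

include h1 in
omit [IsProper 𝓨.total.hom] [IsCommMonObj 𝒜.X] in
/-- The count read through `κ(R) ≅ κ̄(w)`: `Σ_{i : φκ(c_i) = 1} m_i = Σ_{i : c_i ≡ 1 mod 𝔪_R} m_i`. [cite: Liu2021, Remark C.2 p. 108; p. 137] -/
theorem sum_filter_residue_eq_one [DecidableEq (geomResidueField w)] :
    ∑ i ∈ s with (((geomResidueFieldEquiv w).symm.toRingEquiv.toRingHom).comp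
        (IsLocalRing.residue ↥(closureValuationSubring (w.adicCompletion F)))) (c i) = 1, m i = 1 := by
  refine (Finset.sum_congr (Finset.filter_congr fun i _ => ?_) fun _ _ => rfl).trans h1
  change (geomResidueFieldEquiv w).symm (IsLocalRing.residue _ (c i)) = 1 ↔ _
  exact map_eq_one_iff _ (geomResidueFieldEquiv w).symm.injective

include hg hx hcop ha1 ha2 hK₁ h1 in
/-- **SOCKET (S-T) ON THE SPECIAL FIBRE OF THE LIFTED TUPLE** (frame (R-β) on the nose: `A := (𝒜_R).baseChange gκ`).  `𝓨` a proper integral model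
over `𝒪_{F,(w)}` of `Y`, `𝒜 → 𝓨` an abelian scheme of relative dimension `g` with ring action `act` of `O`, `(p) = w′^e 𝔟`, `w′ + 𝔟 = O`, `(a_n)` a block
family, `y ∈ Y(F̄_w)`; `R ⊆ F̄_w` the valuation ring, `x̃ : Spec R → 𝓨` the lift of `y`, `gκ : Spec κ̄(w) → Spec R` the geometric closed point.  INPUT
(K-Ω): on the Ω-fibre tuple at `y` the cotangent map of `ι_y(a₁)` has characteristic polynomial `∏_{i∈s} (T − c_i)^{m_i}`, `c_i ∈ R`, with
`Σ_{i : c_i ≡ 1 mod 𝔪_R} m_i = 1`.  OUTPUT: for every `n ≥ 1`, the cotangent map of `ι(a_n)` on `𝔪_e∕𝔪_e²` of `(𝒜_R ×_R κ̄(w), ι_R ⊗ κ̄(w))` has rank `1`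
— `lieCharpoly_extendPoint_eq_prod` then ★ FILE 1 HEAD `hsig_baseChange_of_lieCharpoly_eq_prod` at `gκ = Spec (R → κ(R) ≅ κ̄(w))`.
[cite: RapoportSmithlingZhang2020Diagonal, §4.1 (4.6) p. 16 and (4.19) p. 19] [cite: Liu2021, Remark C.2 p. 108; p. 137] [cite: SerreTate1968, §1] -/
theorem hsig_specialFibre_extendPoint (n : ℕ) (hn : 0 < n) :
    letI xt : Spec (.of ↥(closureValuationSubring (w.adicCompletion F))) ⟶ 𝓨.total.left :=
      (extendPoint (closureValuationSubring (w.adicCompletion F)) (toClosureValuationSubring w) 𝓨.total (𝓨.modelPointsEquiv.symm y)).left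
    letI gκ : Spec (.of (geomResidueField w)) ⟶ Spec (.of ↥(closureValuationSubring (w.adicCompletion F))) :=
      (geomClosedPointIsoSpecResidueField w).inv.left ≫
        (specRingHomι (closureValuationSubring (w.adicCompletion F)) (toClosureValuationSubring w)
          (IsLocalRing.residue ↥(closureValuationSubring (w.adicCompletion F)))).left
    haveI : IsCommMonObj (((𝒜.baseChange xt).baseChange gκ).X) :=
      inferInstanceAs (IsCommMonObj ((Over.pullback gκ).obj ((Over.pullback xt).obj 𝒜.X)))
    haveI := ((act.baseChange xt).baseChange gκ).isMonHom_i (a n)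
    Module.finrank (geomResidueField w) (LinearMap.range (cotangentMap ((𝒜.baseChange xt).baseChange gκ).toAffine.toAbelianVariety
      (InducedCategory.homMk (Grp.ofHom (A := ((𝒜.baseChange xt).baseChange gκ).X) (B := ((𝒜.baseChange xt).baseChange gκ).X)
        (((act.baseChange xt).baseChange gκ).i (a n)))))) = 1 := by
  classical
  let xt : Spec (.of ↥(closureValuationSubring (w.adicCompletion F))) ⟶ 𝓨.total.left :=
    (extendPoint (closureValuationSubring (w.adicCompletion F)) (toClosureValuationSubring w) 𝓨.total (𝓨.modelPointsEquiv.symm y)).left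
  let gκ : Spec (.of (geomResidueField w)) ⟶ Spec (.of ↥(closureValuationSubring (w.adicCompletion F))) :=
    (geomClosedPointIsoSpecResidueField w).inv.left ≫
      (specRingHomι (closureValuationSubring (w.adicCompletion F)) (toClosureValuationSubring w)
        (IsLocalRing.residue ↥(closureValuationSubring (w.adicCompletion F)))).left
  haveI : IsCommMonObj ((𝒜.baseChange xt).X) := inferInstanceAs (IsCommMonObj ((Over.pullback xt).obj 𝒜.X))
  haveI : IsCommMonObj (((𝒜.baseChange xt).baseChange gκ).X) :=
    inferInstanceAs (IsCommMonObj ((Over.pullback gκ).obj ((Over.pullback xt).obj 𝒜.X)))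
  have hKR := lieCharpoly_extendPoint_eq_prod 𝓨 hg act y (a 1) s c m hK₁
  exact (act.baseChange xt).hsig_baseChange_of_lieCharpoly_eq_prod (hg.baseChange xt) hx hcop a ha1 ha2 s c m hKR gκ _
    specialPoint_eq_specMap (sum_filter_residue_eq_one s c m h1) n hn

end Lifted

/-! ## §3 `hsig` on the datum's own special fibre `(𝒜 ×_𝓨 𝓨_s) ×_{𝓨_s} x̄` at a reduction `x̄ = red_𝓨 y` -/

section Reduction

variable {F : Type} [Field F] [NumberField F] {w : HeightOneSpectrum (𝓞 F)} {Y : SchemeOver F}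
  (𝓨 : IntegralModel (valuationSubringAtPrime F w) F Y) [IsProper 𝓨.total.hom]
  {𝒜 : AbelianSchemeOver 𝓨.total.left} {g : ℕ} (hg : 𝒜.IsOfRelDim g)
  {O : Type v} [CommRing O] (act : RingAction O 𝒜)
  {p : ℕ} {w' 𝔟 : Ideal O} {e : ℕ} (hx : Ideal.span {(p : O)} = w' ^ e * 𝔟) (hcop : w' ⊔ 𝔟 = ⊤)
  (a : ℕ → O) (ha1 : ∀ n, a n - 1 ∈ w' ^ (e * n)) (ha2 : ∀ n, a n ∈ 𝔟 ^ n)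
  (y : AlgPoints Y (AlgebraicClosure (w.adicCompletion F))) {σ : Type*} (s : Finset σ)
  (c : σ → ↥(closureValuationSubring (w.adicCompletion F))) (m : σ → ℕ)
  (hK₁ : letI ιη := 𝓨.genericIso'.inv.left ≫ pullback.fst 𝓨.total.hom (specGenericPoint (valuationSubringAtPrime F w) F)
    haveI := ((act.baseChange ιη).baseChange y.left).isMonHom_i (a 1)
    (cotangentMap ((𝒜.baseChange ιη).baseChange y.left).toAffine.toAbelianVariety
        (InducedCategory.homMk (Grp.ofHom (A := ((𝒜.baseChange ιη).baseChange y.left).X) (B := ((𝒜.baseChange ιη).baseChange y.left).X)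
          (((act.baseChange ιη).baseChange y.left).i (a 1))))).charpoly =
      ∏ i ∈ s, (Polynomial.X - Polynomial.C (algebraMap ↥(closureValuationSubring (w.adicCompletion F))
        (AlgebraicClosure (w.adicCompletion F)) (c i))) ^ m i)
  [CharP (geomResidueField w) p] [DecidableEq (IsLocalRing.ResidueField ↥(closureValuationSubring (w.adicCompletion F)))]
  (h1 : ∑ i ∈ s with IsLocalRing.residue ↥(closureValuationSubring (w.adicCompletion F)) (c i) = 1, m i = 1)
  [IsCommMonObj (((𝒜.baseChange (pullback.fst 𝓨.total.hom (specResidueField w))).baseChange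
    ((𝓨.geomReductionMap y).left : Spec (.of (geomResidueField w)) ⟶ pullback 𝓨.total.hom (specResidueField w))).X)]

include hg hx hcop ha1 ha2 hK₁ h1 in
/-- **SOCKET (S-T) AT A REDUCTION `red_𝓨 y`.**  Same data; the fibre of the special family `𝒜 ×_𝓨 𝓨_s → 𝓨_s` at the reduction `red_𝓨 y : Spec κ̄(w) → 𝓨_s`
of `y ∈ Y(F̄_w)` — the datum's `sch₀Of 𝓜 w 𝒜 (red y)` at `𝓨 := 𝓜.localise w`, with the doubly base-changed action `act₀Of` — satisfies `hsig`: for every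
`n ≥ 1` the cotangent map of `ι(a_n)` on `𝔪_e∕𝔪_e²` has rank `1`.  It is isomorphic, compatibly with every `ι(r)`, to the special fibre of the lifted
family (★ `exists_iso_fibre_special_along_extendPoint`: «reduction of points = reduction of tuples»); the cotangent characteristic polynomial of `ι(a₁)`
moves along the equivariant isomorphism (★ `charpoly_cotangentMap_eq_of_comp_eq_nsmul`, `n = 1`) from ★ FILE 1 §1 on the lifted side
(`lieCharpoly_extendPoint_eq_prod`), and ★ FILE 1 `hsig_of_charpoly_cotangentMap_eq_prod` concludes. [cite: RapoportSmithlingZhang2020Diagonal, §4.1 (4.6) p. 16 and (4.19) p. 19]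
[cite: Liu2021, Remark C.2 p. 108; p. 137] [cite: SerreTate1968, §1] [cite: Kottwitz1992, §5 (p. 390)] -/
theorem hsig_specialFibre_geomReductionMap (n : ℕ) (hn : 0 < n) :
    letI ιs := pullback.fst 𝓨.total.hom (specResidueField w)
    letI xb : Spec (.of (geomResidueField w)) ⟶ pullback 𝓨.total.hom (specResidueField w) := (𝓨.geomReductionMap y).left
    haveI := ((act.baseChange ιs).baseChange xb).isMonHom_i (a n)
    Module.finrank (geomResidueField w) (LinearMap.range (cotangentMap ((𝒜.baseChange ιs).baseChange xb).toAffine.toAbelianVariety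
      (InducedCategory.homMk (Grp.ofHom (A := ((𝒜.baseChange ιs).baseChange xb).X) (B := ((𝒜.baseChange ιs).baseChange xb).X)
        (((act.baseChange ιs).baseChange xb).i (a n)))))) = 1 := by
  classical
  obtain ⟨eI, -, hnat⟩ := exists_iso_fibre_special_along_extendPoint 𝓨 y
  let xt : Spec (.of ↥(closureValuationSubring (w.adicCompletion F))) ⟶ 𝓨.total.left :=
    (extendPoint (closureValuationSubring (w.adicCompletion F)) (toClosureValuationSubring w) 𝓨.total (𝓨.modelPointsEquiv.symm y)).left
  let gκ : Spec (.of (geomResidueField w)) ⟶ Spec (.of ↥(closureValuationSubring (w.adicCompletion F))) :=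
    (geomClosedPointIsoSpecResidueField w).inv.left ≫
      (specRingHomι (closureValuationSubring (w.adicCompletion F)) (toClosureValuationSubring w)
        (IsLocalRing.residue ↥(closureValuationSubring (w.adicCompletion F)))).left
  let φκ : ↥(closureValuationSubring (w.adicCompletion F)) →+* geomResidueField w :=
    ((geomResidueFieldEquiv w).symm.toRingEquiv.toRingHom).comp (IsLocalRing.residue ↥(closureValuationSubring (w.adicCompletion F)))
  let ιs := pullback.fst 𝓨.total.hom (specResidueField w)
  let xb : Spec (.of (geomResidueField w)) ⟶ pullback 𝓨.total.hom (specResidueField w) := (𝓨.geomReductionMap y).left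
  haveI := act.isMonHom_i (a 1)
  haveI := ((act.baseChange xt).baseChange gκ).isMonHom_i (a 1)
  haveI := ((act.baseChange ιs).baseChange xb).isMonHom_i (a 1)
  -- Kottwitz over `R`, then `hχ` on the lifted special fibre (★ FILE 1 §1)
  have hKR := lieCharpoly_extendPoint_eq_prod 𝓨 hg act y (a 1) s c m hK₁
  have hχL := (act.baseChange xt).charpoly_cotangentMap_baseChange_i (hg.baseChange xt) (a 1) gκ φκ specialPoint_eq_specMap
  rw [hKR, Polynomial.map_prod] at hχL
  simp only [Polynomial.map_pow, Polynomial.map_sub, Polynomial.map_X, Polynomial.map_C] at hχL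
  -- transport along the equivariant isomorphism `sch₀ ≅ lifted special fibre`
  have hu : (InducedCategory.homMk (Grp.ofHom (A := ((𝒜.baseChange ιs).baseChange xb).X) (B := ((𝒜.baseChange ιs).baseChange xb).X)
        (((act.baseChange ιs).baseChange xb).i (a 1))) :
          ((𝒜.baseChange ιs).baseChange xb).toAffine.toAbelianVariety ⟶ ((𝒜.baseChange ιs).baseChange xb).toAffine.toAbelianVariety) ≫
        (eI 𝒜).hom =
      (eI 𝒜).hom ≫ (InducedCategory.homMk (Grp.ofHom (A := ((𝒜.baseChange xt).baseChange gκ).X) (B := ((𝒜.baseChange xt).baseChange gκ).X)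
        (((act.baseChange xt).baseChange gκ).i (a 1))) :
          ((𝒜.baseChange xt).baseChange gκ).toAffine.toAbelianVariety ⟶ ((𝒜.baseChange xt).baseChange gκ).toAffine.toAbelianVariety) := by
    rw [homMk_baseChange_i_eq_fibreHom act ιs xb (a 1), homMk_baseChange_i_eq_fibreHom act xt gκ (a 1)]
    exact hnat 𝒜 𝒜 (act.i (a 1))
  have i1 : (eI 𝒜).hom ≫ (eI 𝒜).inv = (1 : ℕ) • 𝟙 _ := by rw [one_smul]; exact (eI 𝒜).hom_inv_id
  have i2 : (eI 𝒜).inv ≫ (eI 𝒜).hom = (1 : ℕ) • 𝟙 _ := by rw [one_smul]; exact (eI 𝒜).inv_hom_id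
  have hχ0 := charpoly_cotangentMap_eq_of_comp_eq_nsmul i1 i2 (by rw [Nat.cast_one]; exact one_ne_zero) hu
  have hχ : (cotangentMap ((𝒜.baseChange ιs).baseChange xb).toAffine.toAbelianVariety
      (InducedCategory.homMk (Grp.ofHom (A := ((𝒜.baseChange ιs).baseChange xb).X) (B := ((𝒜.baseChange ιs).baseChange xb).X)
        (((act.baseChange ιs).baseChange xb).i (a 1))))).charpoly =
      ∏ i ∈ s, (Polynomial.X - Polynomial.C (φκ (c i))) ^ m i :=
    hχ0.trans hχL
  exact ((act.baseChange ιs).baseChange xb).hsig_of_charpoly_cotangentMap_eq_prod hx hcop a ha1 ha2 s (fun i => φκ (c i)) m hχ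
    (sum_filter_residue_eq_one s c m h1) n hn

end Reduction

/-! ## §4 `hsig` at EVERY special point of a smooth proper model -/

/-- **SOCKET (S-T) AT EVERY SPECIAL POINT — the ED. 7 `hsig` binder of `blockDocking_of_line` at `A := sch₀Of 𝓜 w 𝒜 x̄`.**  For a smooth proper
integral model `𝓨` over `𝒪_{F,(w)}`, an abelian scheme `𝒜 → 𝓨` of relative dimension `g` with ring action `act`, a maximal ideal `w′` of `O` with block data
`(p, e, 𝔟, a)`, the Kottwitz input (K-Ω) at EVERY `y ∈ Y(F̄_w)` with roots `c_i ∈ R` and the count `Σ_{i : c_i ≡ 1 mod 𝔪_R} m_i = 1`, and ANY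
`x̄ ∈ 𝓨_s(κ̄(w))`: the cotangent map of `ι(a_n)` on `𝔪_e∕𝔪_e²` of `((𝒜 ×_𝓨 𝓨_s) ×_{𝓨_s} x̄)` has rank `1` for every `n ≥ 1` — every special point of a smooth
proper model is a reduction (★ `IntegralModel.geomReductionMap_surjective_of_isSmoothProper`, Hensel), then §3.  «The `w′`-block of `Lie A_x̄` is a line.»
[cite: RapoportSmithlingZhang2020Diagonal, §4.1 (4.6) p. 16 and (4.19) p. 19] [cite: Liu2021, Remark C.2 p. 108; p. 137] [cite: SerreTate1968, §1] -/
theorem hsig_specialFibre_of_isSmoothProper {F : Type} [Field F] [NumberField F] {w : HeightOneSpectrum (𝓞 F)} {Y : SchemeOver F}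
    (𝓨 : IntegralModel (valuationSubringAtPrime F w) F Y) {d : ℕ} (h𝓨 : 𝓨.IsSmoothProper d)
    {𝒜 : AbelianSchemeOver 𝓨.total.left} {g : ℕ} (hg : 𝒜.IsOfRelDim g)
    {O : Type v} [CommRing O] (act : RingAction O 𝒜)
    {p : ℕ} {w' 𝔟 : Ideal O} {e : ℕ} (hx : Ideal.span {(p : O)} = w' ^ e * 𝔟) (hcop : w' ⊔ 𝔟 = ⊤)
    (a : ℕ → O) (ha1 : ∀ n, a n - 1 ∈ w' ^ (e * n)) (ha2 : ∀ n, a n ∈ 𝔟 ^ n)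
    {σ : Type*} (s : Finset σ) (c : σ → ↥(closureValuationSubring (w.adicCompletion F))) (m : σ → ℕ)
    (hK : haveI : IsProper 𝓨.total.hom := h𝓨.2
      ∀ y : AlgPoints Y (AlgebraicClosure (w.adicCompletion F)),
      letI ιη := 𝓨.genericIso'.inv.left ≫ pullback.fst 𝓨.total.hom (specGenericPoint (valuationSubringAtPrime F w) F)
      haveI := ((act.baseChange ιη).baseChange y.left).isMonHom_i (a 1)
      (cotangentMap ((𝒜.baseChange ιη).baseChange y.left).toAffine.toAbelianVariety
          (InducedCategory.homMk (Grp.ofHom (A := ((𝒜.baseChange ιη).baseChange y.left).X) (B := ((𝒜.baseChange ιη).baseChange y.left).X)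
            (((act.baseChange ιη).baseChange y.left).i (a 1))))).charpoly =
        ∏ i ∈ s, (Polynomial.X - Polynomial.C (algebraMap ↥(closureValuationSubring (w.adicCompletion F))
          (AlgebraicClosure (w.adicCompletion F)) (c i))) ^ m i)
    [CharP (geomResidueField w) p] [DecidableEq (IsLocalRing.ResidueField ↥(closureValuationSubring (w.adicCompletion F)))]
    (h1 : ∑ i ∈ s with IsLocalRing.residue ↥(closureValuationSubring (w.adicCompletion F)) (c i) = 1, m i = 1)
    (xbar : AlgPoints 𝓨.reductionAt (geomResidueField w))
    [IsCommMonObj (((𝒜.baseChange (pullback.fst 𝓨.total.hom (specResidueField w))).baseChange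
      (xbar.left : Spec (.of (geomResidueField w)) ⟶ pullback 𝓨.total.hom (specResidueField w))).X)]
    (n : ℕ) (hn : 0 < n) :
    letI ιs := pullback.fst 𝓨.total.hom (specResidueField w)
    letI xb : Spec (.of (geomResidueField w)) ⟶ pullback 𝓨.total.hom (specResidueField w) := xbar.left
    haveI := ((act.baseChange ιs).baseChange xb).isMonHom_i (a n)
    Module.finrank (geomResidueField w) (LinearMap.range (cotangentMap ((𝒜.baseChange ιs).baseChange xb).toAffine.toAbelianVariety
      (InducedCategory.homMk (Grp.ofHom (A := ((𝒜.baseChange ιs).baseChange xb).X) (B := ((𝒜.baseChange ιs).baseChange xb).X)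
        (((act.baseChange ιs).baseChange xb).i (a n)))))) = 1 := by
  haveI := h𝓨.2
  obtain ⟨y, rfl⟩ := 𝓨.geomReductionMap_surjective_of_isSmoothProper h𝓨 xbar
  exact hsig_specialFibre_geomReductionMap 𝓨 hg act hx hcop a ha1 ha2 y s c m (hK y) h1 n hn

end RingAction

end Literature.AlgebraicGeometry.HodgeTheory

end
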